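import Summits.HodgeConjecture.HodgeConjecture.Theorems.SeparatedCyclotomicSelfMapSquareHodge

/-!
# TWIST-SEP, I — the non-separated extension of CYC-SEP: typed statements `TwistSepEndSpan` ∕ `TwistSepSquareHodge` and semilinear line algebra over `ℚ(ζ_N)`

Part 1 of 3 (Sketch §A + §A′ steps (0)–(3), ll. 45–299). If the type table `deg` of a cyclotomic action `a` (order `N`, `dim T = φ(N)`) on a
Hodge structure `T` has stabiliser `W = {w : deg (w u) = deg u ∀ u} ≠ 1`, then `End_Hdg(T) = ⊕_{w ∈ W} ℚ(a) · p_w` with `p_w` ANY non-zero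
`σ_w`-semilinear Hodge endomorphism (`p_w a = a^w p_w`). This part: the two `Prop`s (§A) and, in `namespace TwistSep`, (0) semiconjugation by
polynomials, (1) `V` is a line over the field `ℚ[α] ≅ ℚ(ζ_N)` (`cyclotomicLine`), (2) eigenlines of a diagonalisable operator with simple spectrum,
(3) non-zero `α`-semilinear endomorphisms are injective and the `t`-semilinear ones form a `ℚ[α]`-line (`injective_of_semiconj`, `exists_eq_aeval_mul`).

PROVENANCE. Cell hodge-nonav (HUMAN RULING D-0038), planner seat p1 g32: chapter ROUTE-P1AE §A (memo `HOME/memos/ROUTE-P1AE.md`),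
frozen Sketch `HOME/p1/route/Sketch_P1AE_GRPSEP_g32.lean` (sha16 38cae48bc3bf4f6b, 1242 lines, namespace `HodgeNonAV.P1AE`, farm rc 0 /
0 sorries / axioms {propext, Classical.choice, Quot.sound}; referee PASS: ref g50, REF-P1AE.md 05a6fdcdc7be5ad5), §A/§A′/§A″ split into three
tree modules `TwistedCyclotomicSelfMapSquareHodgeSemilinear` → `…Abstract` → `TwistedCyclotomicSelfMapSquareHodge` by planner p1 g34 (landing
kit HOME/p1/landing/, 2026-08-28); bodies verbatim (§B of the Sketch is superseded by `Theorems/FermatSurfaceSeparation*` and omitted).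
Extends the K6-landed `Theorems/SeparatedCyclotomicSelfMapSquareHodge{Abstract,}` (p576675 ∕ p577238: CYC-SEP = the case `W = 1`).
Land with `--supports stmt-HodgeConjecture-19652 --as helper`. No instance, no new notation (four `local notation3` of Part 3 are the
tree's, verbatim from `Theorems/SeparatedCyclotomicSelfMapSquareHodge`), no sorry, no new axiom.
HONEST SCOPE: `HC⁴(S × S)` for surfaces `S` with `p_g = 1`-type cyclotomic self-maps whose type table has a non-trivial stabiliser `W`,
GIVEN further self-maps realising the twists — all such `S × S` known to us are dominated by products of curves ∕ Fermat quotients, so this is a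
re-proof engine inside the known region; NOTHING here proves the Hodge conjecture.
References: Green–Griffiths–Kerr, *Mumford–Tate groups and domains* (2012) §V.C [cite: GreenGriffithsKerr2012, §V.C]; T. Shioda, Math. Ann.
245 (1979) Thm II, IV [cite: Shioda1979, Thm. II]; D. Huybrechts, *Lectures on K3 surfaces* (2016) Ch. 3 [cite: Huybrechts2016K3, Ch. 3];
C. Voisin, *Hodge theory I* (2002) §11 [cite: VoisinHodgeI2002, Thm. 11.41].
-/

set_option linter.dupNamespace false

noncomputable section

namespace Summit.HodgeConjecture.HodgeConjecture.Theorems.TwistedCyclotomicSelfMapSquareHodge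

open scoped TensorProduct
open CategoryTheory MonoidalCategory
open Literature.AlgebraicGeometry Literature.AlgebraicGeometry.Motives Literature.AlgebraicGeometry.HodgeTheory
open Literature.AlgebraicTopology.SingularHomology
open Literature.AlgebraicGeometry.Motives.HodgeStructure Literature.AlgebraicGeometry.Surfaces
open Summit.HodgeConjecture.HodgeConjecture.Theorems.PgOneCyclotomicSquares
open Summit.HodgeConjecture.HodgeConjecture.Theorems.SeparatedCyclotomicSelfMapSquareHodge
open Polynomial

/-! ## §A  TWIST-SEP — the non-separated extension of CYC-SEP (typed statements) -/

section TwistSep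

universe u

/-- **TWIST-SEP-1 (abstract; typed — PROVED in §A′ below, `twistSepEndSpan_holds`).** Hypotheses of the tree's `coe_endAlg_mem_span_pow_of_separated`
WITHOUT separation; instead a finite family `p k ∈ End_Hdg(H)` of non-zero Hodge endomorphisms, `p k ∘ a = a^{t k} ∘ p k`,
whose twists `t k` cover the stabiliser `W = {w : ∀ u, deg (w u) = deg u}` of the type table up to `w = 1`.
CLAIM: `End_Hdg(H) ⊆ span_ℚ ({a^i} ∪ {a^i ∘ p k})`. Proof plan (memo ROUTE-P1AE §A): for `g ∈ End_Hdg`, the averages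
`Ψ_t(g) = N⁻¹ ∑ᵢ a^{-t i} g aⁱ` are the `σ_t`-semilinear parts of `g` (`g = ∑_t Ψ_t g`), each in `End_Hdg`; a non-zero
`σ_t`-semilinear Hodge endomorphism is injective (its kernel is `a`-stable and rational, `Φ_N` irreducible), hence has
`deg (t u) ≤ deg u` for all `u`, hence `t ∈ W` (finite order); and two non-zero `σ_t`-semilinear endomorphisms differ
by an element of `End_{ℚ(a)}(H) = ℚ(a)`. (Refs.: GreenGriffithsKerr2012 §V.C (i),(ii); Shioda1979 Thm. II — a statement of THIS
line, proved below, not a cited fact.) [cell hodge-nonav memo ROUTE-P1AE §A] -/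
def TwistSepEndSpan : Prop :=
  ∀ (V : Type u) [AddCommGroup V] [Module ℚ V] [Module.Finite ℚ V] (n : ℤ) (H : HodgeStructure V n)
    (a : H.endAlg) (N : ℕ), 0 < N → ∀ (ζ : ℂ), IsPrimitiveRoot ζ N →
    ∀ (deg : (ZMod N)ˣ → ℤ) (ω : (ZMod N)ˣ → ℂ ⊗[ℚ] V), (∀ u, ω u ≠ 0) →
    (∀ u, ω u ∈ H.F (deg u)) → (∀ u, ω u ∉ H.F (deg u + 1)) →
    (∀ u, ((a : Module.End ℚ V).baseChange ℂ) (ω u) = ζ ^ (u : ZMod N).val • ω u) →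
    Module.finrank ℚ V = Nat.totient N →
    ∀ (K : Type) [Fintype K] (p : K → H.endAlg) (t : K → (ZMod N)ˣ),
    (∀ k, (p k : Module.End ℚ V) ≠ 0) →
    (∀ k, (p k : Module.End ℚ V) * (a : Module.End ℚ V) =
      (a : Module.End ℚ V) ^ ((t k : ZMod N).val) * (p k : Module.End ℚ V)) →
    (∀ w : (ZMod N)ˣ, (∀ u, deg (w * u) = deg u) → w = 1 ∨ ∃ k, t k = w) →
    ∀ g : H.endAlg, (g : Module.End ℚ V) ∈ Submodule.span ℚ
      ((Set.range fun i : Fin N ↦ (a : Module.End ℚ V) ^ (i : ℕ)) ∪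
        Set.range fun ki : K × Fin N ↦ (a : Module.End ℚ V) ^ (ki.2 : ℕ) * (p ki.1 : Module.End ℚ V))

variable {S : SchemeOver ℂ}

/-- **TWIST-SEP-2 (geometric) ⇒ `HC⁴(S × S)` — PROVED in §A″ below (`twistSepSquareHodge_holds`).** Hypotheses of the tree's
`hodgeConjectureFor_square_of_separatedCyclotomicSelfMap` WITHOUT `hsep`; instead further self-maps `σ k : S ⟶ S`
(`k ∈ K` finite) acting on the eigenlines by `(σ k)^* ω_{t_k u} = c_{k,u} ω_u`, `c_{k,u} ≠ 0` (so `(σ k)^* τ^* = (τ^*)^{t_k} (σ k)^*`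
on `T(S)_ℂ`), with twists `t k` covering the stabiliser of `deg` up to `1`. CLAIM: `HodgeConjectureFor 4 (S ⊗ S)`.
Proof plan: TWIST-SEP-1 on `T = (Hdg¹)^⊥` with `a = τ^*|_T`, `p k = (σ k)^*|_T` (Level-2 plumbing of the tree file), then
SQ-AUT `hodgeConjectureFor_square_of_endomorphisms` with the family `{τ^i} ∪ {σ_k ∘ τ^i}`. CYC-SEP is the case `K = ∅`.
Customers: non-separated classes of the Delsarte census whose stabiliser is realised by automorphisms (memo §C).
(Refs.: Shioda1979 Thm. II; VoisinHodgeI2002 §11.3.3 — a statement of THIS line, proved in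
`TwistedCyclotomicSelfMapSquareHodge`, not a cited fact.) [cell hodge-nonav memo ROUTE-P1AE §A] -/
def TwistSepSquareHodge : Prop :=
  ∀ (S : SchemeOver ℂ) (_hS : IsSmoothProjective 2 S) (τ : S ⟶ S) (N : ℕ), 0 < N → ∀ (ζ : ℂ), IsPrimitiveRoot ζ N →
    ∀ (deg : (ZMod N)ˣ → ℕ), (∀ u, deg u ≤ 2) →
    ∀ (ω : (ZMod N)ˣ → complexBetti S (2 * 1)), (∀ u, ω u ≠ 0) →
    (∀ u, IsOfHodgeType 2 S (2 * 1) (deg u) (2 - deg u) (ω u)) →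
    (∀ u, ∀ d ∈ algebraicClasses S 1, cupProduct (rfl : 2 * 1 + 2 * 1 = 2 * 2) (ω u) d = 0) →
    (∀ u, complexBetti.map τ (2 * 1) (ω u) = ζ ^ (u : ZMod N).val • ω u) →
    Module.finrank ℂ (algebraicClasses S 1) + Nat.totient N = Module.finrank ℂ (complexBetti S (2 * 1)) →
    ∀ (K : Type) [Fintype K] (σ : K → (S ⟶ S)) (t : K → (ZMod N)ˣ) (c : K → (ZMod N)ˣ → ℂ),
    (∀ k u, c k u ≠ 0) → (∀ k u, complexBetti.map (σ k) (2 * 1) (ω (t k * u)) = c k u • ω u) →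
    (∀ w : (ZMod N)ˣ, (∀ u, deg (w * u) = deg u) → w = 1 ∨ ∃ k, t k = w) →
    HodgeConjectureFor 4 (S ⊗ S)

/-- Sanity (CYC-SEP is the case `K = PEmpty` of TWIST-SEP-2): the separated case of the statement is the tree's
Level-2 theorem. [tree: Theorems/SeparatedCyclotomicSelfMapSquareHodge] -/
theorem twistSepSquareHodge_of_separated (hS : IsSmoothProjective 2 S)
    (τ : S ⟶ S) {N : ℕ} (hN : 0 < N) {ζ : ℂ} (hζ : IsPrimitiveRoot ζ N)
    (deg : (ZMod N)ˣ → ℕ) (hdeg : ∀ u, deg u ≤ 2)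
    (ω : (ZMod N)ˣ → complexBetti S (2 * 1)) (hω0 : ∀ u, ω u ≠ 0)
    (hωtype : ∀ u, IsOfHodgeType 2 S (2 * 1) (deg u) (2 - deg u) (ω u))
    (hωorth : ∀ u, ∀ d ∈ algebraicClasses S 1, cupProduct (rfl : 2 * 1 + 2 * 1 = 2 * 2) (ω u) d = 0)
    (heig : ∀ u, complexBetti.map τ (2 * 1) (ω u) = ζ ^ (u : ZMod N).val • ω u)
    (hrk : Module.finrank ℂ (algebraicClasses S 1) + Nat.totient N =
      Module.finrank ℂ (complexBetti S (2 * 1)))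
    (hcover : ∀ w : (ZMod N)ˣ, (∀ u, deg (w * u) = deg u) → w = 1 ∨ ∃ k : PEmpty, PEmpty.elim k = w) :
    HodgeConjectureFor 4 (S ⊗ S) :=
  hodgeConjectureFor_square_of_separatedCyclotomicSelfMap hS τ hN hζ deg hdeg ω hω0 hωtype hωorth heig hrk
    fun w hw ↦ (hcover w hw).elim id fun ⟨k, _⟩ ↦ k.elim

end TwistSep

/-! ## §A′  TWIST-SEP-1 PROVED (kernel): the non-separated extension of CYC-SEP, Level 1

The development below proves `TwistSepEndSpan` (`twistSepEndSpan_holds`, axioms standard). Structure: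
(0) semiconjugation by polynomials; (1) `V` is a line over the field `ℚ[α] ≅ ℚ(ζ_N)` (`cyclotomicLine`);
(2) eigenlines of a diagonalisable operator with simple spectrum; (3) non-zero semilinear endomorphisms are injective,
and the `t`-semilinear endomorphisms form a `ℚ[α]`-line (`injective_of_semiconj`, `exists_eq_aeval_mul`);
(4) KEY HODGE STEP `deg_mul_eq_of_semiconj`: an injective `t`-semilinear Hodge endomorphism forces `t ∈ W`;
(5) the twisted averaging operators `Ψ_t(g) = Σ_k α^{-tk} g α^k` (`semiconj_twistAverage`, `sum_twistAverage`:
`Σ_t Ψ_t(g) = N g`, a character-sum computation on the eigenbasis); (6) assembly `coe_endAlg_mem_span_of_twists`. -/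

section TwistSepProof

namespace TwistSep

universe u

variable {V : Type u} [AddCommGroup V] [Module ℚ V]

/-! ### (0) semiconjugation by polynomials -/

/-- `h α = β h ⇒ h q(α) = q(β) h`. [folklore] -/
theorem semiconjBy_aeval {h α β : Module.End ℚ V} (hs : SemiconjBy h α β) (q : ℚ[X]) :
    SemiconjBy h (aeval α q) (aeval β q) := by
  induction q using Polynomial.induction_on' with
  | add p q hp hq => rw [map_add, map_add]; exact hp.add_right hq
  | monomial k c =>
    rw [aeval_monomial, aeval_monomial]
    have hc : SemiconjBy h (algebraMap ℚ (Module.End ℚ V) c) (algebraMap ℚ (Module.End ℚ V) c) :=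
      (Algebra.commutes c h).symm
    exact hc.mul_right (hs.pow_right k)

/-! ### (1) `V` is a line over the field `ℚ[α] ≅ ℚ(ζ_N)` -/

/-- If `Φ_N(α) = 0` and `dim V = φ(N)`, then every `q(α)` is `0` or invertible, and `V = ℚ[α]·x` for every `x ≠ 0`. [folklore] -/
theorem cyclotomicLine [Module.Finite ℚ V] {α : Module.End ℚ V} {N : ℕ} (hN : 0 < N)
    (hΦ : aeval α (cyclotomic N ℚ) = 0) (hrk : Module.finrank ℚ V = Nat.totient N) :
    (∀ q : ℚ[X], aeval α q = 0 ∨ IsUnit (aeval α q)) ∧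
      ∀ x : V, x ≠ 0 → ∀ y : V, ∃ q : ℚ[X], aeval α q x = y := by
  haveI : NeZero N := ⟨hN.ne'⟩
  let K := CyclotomicField N ℚ
  haveI hKc : IsCyclotomicExtension {N} ℚ K := CyclotomicField.isCyclotomicExtension N ℚ
  haveI : NumberField K := IsCyclotomicExtension.numberField {N} ℚ K
  set ζK : K := IsCyclotomicExtension.zeta N ℚ K with hζKdef
  have hζK : IsPrimitiveRoot ζK N := IsCyclotomicExtension.zeta_spec N ℚ K
  have hirrQ : Irreducible (cyclotomic N ℚ) := cyclotomic.irreducible_rat hN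
  set pb : PowerBasis ℚ K := hζK.powerBasis ℚ with hpbdef
  have hpbgen : pb.gen = ζK := by rw [hpbdef, IsPrimitiveRoot.powerBasis_gen]
  have hminpoly : minpoly ℚ pb.gen = cyclotomic N ℚ := by
    rw [hpbgen, ← hζK.minpoly_eq_cyclotomic_of_irreducible hirrQ]
  have hy : aeval α (minpoly ℚ pb.gen) = 0 := by rw [hminpoly, hΦ]
  set η : K →ₐ[ℚ] Module.End ℚ V := pb.lift α hy with hηdef
  have hη_aeval : ∀ p : ℚ[X], η (aeval ζK p) = aeval α p := fun p ↦ by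
    rw [← hpbgen]; exact pb.lift_aeval α hy p
  have hηpoly : ∀ e : K, ∃ p : ℚ[X], η e = aeval α p := fun e ↦ by
    obtain ⟨p, hp⟩ := pb.exists_eq_aeval' e
    exact ⟨p, by rw [hp, hpbgen, hη_aeval]⟩
  have hS' : Module.finrank ℚ K = Module.finrank ℚ V := by
    rw [IsCyclotomicExtension.finrank K hirrQ, hrk]
  refine ⟨fun q ↦ ?_, fun x hx y ↦ ?_⟩
  · by_cases he : aeval ζK q = 0
    · left
      rw [← hη_aeval, he, map_zero]
    · right
      rw [← hη_aeval]
      exact (IsUnit.mk0 _ he).map η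
  · -- the evaluation map `e ↦ η(e) x` is injective, hence surjective
    let φ : K →ₗ[ℚ] V :=
      { toFun := fun e ↦ η e x
        map_add' := fun e e' ↦ by rw [map_add, LinearMap.add_apply]
        map_smul' := fun c e ↦ by rw [map_smul, LinearMap.smul_apply, RingHom.id_apply] }
    have hφ : ∀ e, φ e = η e x := fun e ↦ rfl
    have hinj : Function.Injective φ := by
      rw [injective_iff_map_eq_zero]
      intro e he
      by_contra hne
      apply hx
      have h1 : η e⁻¹ (η e x) = x := by
        rw [← Module.End.mul_apply, ← map_mul, inv_mul_cancel₀ hne, map_one, Module.End.one_apply]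
      rw [← h1, ← hφ, he, map_zero]
    have hsurj : Function.Surjective φ := (LinearMap.injective_iff_surjective_of_finrank_eq_finrank hS').1 hinj
    obtain ⟨e, he⟩ := hsurj y
    obtain ⟨p, hp⟩ := hηpoly e
    exact ⟨p, by rw [← hp, ← hφ, he]⟩

/-! ### (2) eigenlines of a diagonalisable operator with simple spectrum -/

/-- If `T ω_j = μ_j ω_j` for a basis `ω` and pairwise distinct `μ_j`, an eigenvector of `T` for `μ_i` is a multiple of `ω_i`.
[folklore] -/
theorem exists_eq_smul_of_eigen {ι : Type*} [Fintype ι] [DecidableEq ι] {W : Type*} [AddCommGroup W] [Module ℂ W]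
    {ω : ι → W} (hli : LinearIndependent ℂ ω) (hspan : Submodule.span ℂ (Set.range ω) = ⊤)
    {T : Module.End ℂ W} {μ : ι → ℂ} (hμ : Function.Injective μ) (hT : ∀ j, T (ω j) = μ j • ω j)
    (i : ι) {x : W} (hx : T x = μ i • x) : ∃ c : ℂ, x = c • ω i := by
  let B : Module.Basis ι ℂ W := Module.Basis.mk hli (by rw [hspan])
  have hB : ∀ j, B j = ω j := fun j ↦ Module.Basis.mk_apply hli _ j
  have hx' : x = ∑ j, B.repr x j • ω j := by
    conv_lhs => rw [← B.sum_repr x]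
    simp only [hB]
  obtain ⟨c, rfl⟩ : ∃ c : ι → ℂ, x = ∑ j, c j • ω j := ⟨fun j ↦ B.repr x j, hx'⟩
  have h1 : T (∑ j, c j • ω j) = ∑ j, (c j * μ j) • ω j := by
    rw [map_sum]
    refine Finset.sum_congr rfl fun j _ ↦ ?_
    rw [map_smul, hT, smul_smul]
  have h2 : μ i • (∑ j, c j • ω j) = ∑ j, (μ i * c j) • ω j := by
    rw [Finset.smul_sum]
    refine Finset.sum_congr rfl fun j _ ↦ ?_
    rw [smul_smul]
  have hco : ∀ j, c j * μ j = μ i * c j := fun j ↦ hli.eq_coords_of_eq (h1.symm.trans (hx.trans h2)) j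
  have hcz : ∀ j, j ≠ i → c j = 0 := by
    intro j hj
    have h := hco j
    rw [mul_comm (μ i), ← sub_eq_zero, ← mul_sub, mul_eq_zero] at h
    rcases h with h | h
    · exact h
    · exact absurd (hμ (sub_eq_zero.1 h)) hj
  refine ⟨c i, ?_⟩
  rw [Finset.sum_eq_single i (fun j _ hj ↦ by rw [hcz j hj, zero_smul]) (fun h ↦ absurd (Finset.mem_univ i) h)]

/-! ### (3) non-zero `α`-semilinear endomorphisms are injective; semilinear endomorphisms of one type form a `ℚ[α]`-line -/

/-- A non-zero `h` with `h α = β h` is injective (its kernel is a non-zero `ℚ[α]`-submodule of the `ℚ[α]`-line `V`). [folklore] -/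
theorem injective_of_semiconj [Module.Finite ℚ V] {α : Module.End ℚ V} {N : ℕ} (hN : 0 < N)
    (hΦ : aeval α (cyclotomic N ℚ) = 0) (hrk : Module.finrank ℚ V = Nat.totient N)
    {h β : Module.End ℚ V} (hs : SemiconjBy h α β) (hh : h ≠ 0) : Function.Injective h := by
  obtain ⟨-, hline⟩ := cyclotomicLine hN hΦ hrk
  rw [← LinearMap.ker_eq_bot]
  by_contra hker
  obtain ⟨x, hxker, hx0⟩ := Submodule.exists_mem_ne_zero_of_ne_bot hker
  apply hh
  ext y
  obtain ⟨q, rfl⟩ := hline x hx0 y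
  rw [LinearMap.zero_apply, ← Module.End.mul_apply, (semiconjBy_aeval hs q).eq, Module.End.mul_apply,
    LinearMap.mem_ker.1 hxker, map_zero]

/-- `α^k = α^{k mod N}` when `α^N = 1`. [folklore] -/
theorem pow_eq_pow_mod {α : Module.End ℚ V} {N : ℕ} (hαN : α ^ N = 1) (k : ℕ) : α ^ k = α ^ (k % N) := by
  conv_lhs => rw [← Nat.mod_add_div k N, pow_add, pow_mul, hαN, one_pow, mul_one]

/-- `(α^t)^{t⁻¹} = α` for a unit `t` mod `N`, when `α^N = 1`. [folklore] -/
theorem pow_val_pow_val_inv {α : Module.End ℚ V} {N : ℕ} [NeZero N] (hαN : α ^ N = 1) (t : (ZMod N)ˣ) :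
    (α ^ (t : ZMod N).val) ^ ((t⁻¹ : (ZMod N)ˣ) : ZMod N).val = α := by
  rw [← pow_mul, pow_eq_pow_mod hαN, ← ZMod.val_mul, ← Units.val_mul, mul_inv_cancel, Units.val_one,
    ZMod.val_one_eq_one_mod, ← pow_eq_pow_mod hαN, pow_one]

/-- An endomorphism commuting with `α` is a polynomial in `α` (`V` is a `ℚ[α]`-line). [folklore] -/
theorem exists_eq_aeval_of_commute [Module.Finite ℚ V] {α : Module.End ℚ V} {N : ℕ} (hN : 0 < N)
    (hΦ : aeval α (cyclotomic N ℚ) = 0) (hrk : Module.finrank ℚ V = Nat.totient N)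
    {l : Module.End ℚ V} (hl : SemiconjBy l α α) : ∃ q : ℚ[X], l = aeval α q := by
  obtain ⟨-, hline⟩ := cyclotomicLine hN hΦ hrk
  have hpos : 0 < Module.finrank ℚ V := by rw [hrk]; exact Nat.totient_pos.2 hN
  obtain ⟨x, hx⟩ := (Module.finrank_pos_iff_exists_ne_zero (R := ℚ) (M := V)).1 hpos
  obtain ⟨q₀, hq₀⟩ := hline x hx (l x)
  refine ⟨q₀, LinearMap.ext fun y ↦ ?_⟩
  obtain ⟨q, rfl⟩ := hline x hx y
  rw [← Module.End.mul_apply, (semiconjBy_aeval hl q).eq, Module.End.mul_apply, ← hq₀, ← Module.End.mul_apply,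
    ← Module.End.mul_apply, ← map_mul, ← map_mul, mul_comm]

/-- Two `t`-semilinear endomorphisms, one injective, differ by a factor in `ℚ[α]`: `h = q(α) ∘ p`. [folklore] -/
theorem exists_eq_aeval_mul [Module.Finite ℚ V] {α : Module.End ℚ V} {N : ℕ} (hN : 0 < N)
    (hΦ : aeval α (cyclotomic N ℚ) = 0) (hαN : α ^ N = 1) (hrk : Module.finrank ℚ V = Nat.totient N)
    {h p : Module.End ℚ V} {t : (ZMod N)ˣ} (hh : SemiconjBy h α (α ^ (t : ZMod N).val))
    (hp : SemiconjBy p α (α ^ (t : ZMod N).val)) (hpinj : Function.Injective p) :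
    ∃ q : ℚ[X], h = aeval α q * p := by
  haveI : NeZero N := ⟨hN.ne'⟩
  set β : Module.End ℚ V := α ^ (t : ZMod N).val with hβ
  set ps : Module.End ℚ V := ((LinearEquiv.ofInjectiveEndo p hpinj).symm : V →ₗ[ℚ] V) with hpsdef
  have hright : p * ps = 1 := LinearEquiv.ofInjectiveEndo_right_inv p hpinj
  have hleft : ps * p = 1 := LinearEquiv.ofInjectiveEndo_left_inv p hpinj
  -- `ps β = α ps`
  have hps : SemiconjBy ps β α := by
    show ps * β = α * ps
    calc ps * β = ps * β * (p * ps) := by rw [hright, mul_one]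
      _ = ps * (β * p) * ps := by simp only [mul_assoc]
      _ = ps * (p * α) * ps := by rw [hp.eq]
      _ = (ps * p) * α * ps := by simp only [mul_assoc]
      _ = α * ps := by rw [hleft, one_mul]
  -- `l := h ps` commutes with `β`, hence with `α = β^{t⁻¹}`
  have hl : SemiconjBy (h * ps) β β := hh.mul_left hps
  have hlα : SemiconjBy (h * ps) α α := by
    have := hl.pow_right ((t⁻¹ : (ZMod N)ˣ) : ZMod N).val
    rwa [hβ, pow_val_pow_val_inv hαN t] at this
  obtain ⟨q, hq⟩ := exists_eq_aeval_of_commute hN hΦ hrk hlα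
  exact ⟨q, by rw [← hq, mul_assoc, hleft, mul_one]⟩

end TwistSep

end TwistSepProof

end Summit.HodgeConjecture.HodgeConjecture.Theorems.TwistedCyclotomicSelfMapSquareHodge

end
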